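import Mathlib
import Summits.NavierStokesRegularity.NavierStokesRegularity.Theorems.EulerZoomLiouvillePowerGaugeEulerLiouvilleNeedleStagnationKinematics

/-!
# THE STAGNATION SET OF THE SIMILARITY WIND IS LEBESGUE-NULL (ROUND-40 §2′ (N2), nsreg-p2 g33)

Width piece for crux `EulerZoomLiouville.PowerGaugeEulerLiouville` (stmt-NavierStokesRegularity-19832), by name under
LEAD 19832 (ns-typeII-p2 g12); seat ns-in-ser-c g3 (director-ns inputs-36), `--supports stmt-NavierStokesRegularity-19832
--as helper`.  Sequel of t40e `…NeedleStagnationKinematics` ((N1): `|γ| ≤ ‖DW(z)‖` at every point for the similarity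
wind `W = γ y + U` of a self-similar Euler profile, `Stagnation.abs_le_norm_fderiv_selfSimilarTransport_of_profile`).

* (Z1) `volume_setOf_eq_zero_inter_deriv_ne_zero` — ONE VARIABLE: for `g ∈ C¹(ℝ)` the set of NON-DEGENERATE ZEROS
  `{t | g t = 0 ∧ g′ t ≠ 0}` is Lebesgue-null.  Elementary: each such zero has a rational interval on which `g′` keeps its
  sign (intermediate value theorem), hence on which `g` is injective (`injOn_Icc_of_deriv_ne_zero`) and has at most one
  zero; the set is a countable union of subsingletons.  No Sard theorem, no area formula.
* (Z2) `volume_setOf_eq_zero_inter_fderiv_apply_ne_zero` — FUBINI ON `eⱼ`-LINES: for `f ∈ C¹(ℝ³)` and a coordinate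
  direction `eⱼ`, `vol {z | f z = 0 ∧ Df(z)eⱼ ≠ 0} = 0`: in the volume-preserving line coordinates
  `(w, t) ↦ toLp (insertNth j t w)` (`PiLp.volume_preserving_toLp` ∘ `volume_preserving_piFinSuccAbove` ∘ swap; the line is
  `t ↦ P + t•eⱼ`, `toLp_insertNth_eq_add_smul`) every `w`-section is the (Z1)-set of `g = f ∘ line`
  (`Measure.measure_prod_null`).
* (Z3) `volume_zeroSet_eq_zero_of_fderiv_ne_zero` — for `W ∈ C¹(ℝ³, ℝ³)` whose derivative vanishes at no zero,
  `vol {W = 0} = 0`: `{W = 0} ⊆ ⋃ᵢⱼ {Wᵢ = 0 ∧ ∂ⱼWᵢ ≠ 0}`, nine (Z2)-sets.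
* **(N2) `volume_stagnationSet_eq_zero`** — for a self-similar Euler profile with `γ ≠ 0`, the STAGNATION SET
  `𝒩 = {W = 0}` of the similarity wind has Lebesgue measure zero ((Z3) + (N1)).

MEANING (ROUND-40 §2′): the needle's backward orbits can only hover near `𝒩`, and `𝒩` itself carries no volume; the
quantitative version ((N3), `δ`-thin near-stagnation) is the next text.
HONEST FRAMING: measure bookkeeping for HYPOTHETICAL self-similar Euler profiles; proves nothing about the crux E (19832 OPEN),
any door Target, or Navier–Stokes regularity; no summit statement is touched. [folklore]
-/

noncomputable section

open Set Filter Topology Metric Function MeasureTheory WithLp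
open scoped RealInnerProductSpace NNReal ENNReal

set_option linter.dupNamespace false

namespace Summit.NavierStokesRegularity.NavierStokesRegularity.Theorems.PowerGaugeEulerLiouville.Stagnation

open Literature.Analysis Literature.Analysis.FluidPDE

/-! ## (Z1) One variable: non-degenerate zeros of a `C¹` function form a null set -/

/-- On an interval on which the (continuous) derivative of `g ∈ C¹` does not vanish, `g` is injective: by the
intermediate value theorem `g′` keeps its sign there, so `g` is strictly monotone. [folklore] -/
theorem injOn_Icc_of_deriv_ne_zero {g : ℝ → ℝ} (hg : ContDiff ℝ 1 g) {a b : ℝ}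
    (hne : ∀ t ∈ Icc a b, deriv g t ≠ 0) : InjOn g (Icc a b) := by
  have hgc : Continuous g := hg.continuous
  have hdc : Continuous (deriv g) := hg.continuous_deriv le_rfl
  by_cases hab : a ≤ b
  swap
  · intro x hx; exact absurd (hx.1.trans hx.2) hab
  -- the derivative keeps its sign on `Icc a b`
  have hsign : (∀ t ∈ Icc a b, 0 < deriv g t) ∨ (∀ t ∈ Icc a b, deriv g t < 0) := by
    by_cases ha : 0 < deriv g a
    · left
      intro t ht
      by_contra hle
      have hlt : deriv g t < 0 := lt_of_le_of_ne (not_lt.1 hle) (hne t ht)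
      have hsub : uIcc a t ⊆ Icc a b := by
        rw [uIcc_of_le ht.1]; exact Icc_subset_Icc le_rfl ht.2
      have h0 : (0 : ℝ) ∈ uIcc (deriv g a) (deriv g t) := by
        rw [uIcc_comm, uIcc_of_le (hlt.le.trans ha.le)]; exact ⟨hlt.le, ha.le⟩
      obtain ⟨c, hc, hc0⟩ := intermediate_value_uIcc hdc.continuousOn h0
      exact hne c (hsub hc) hc0
    · right
      have ha' : deriv g a < 0 := lt_of_le_of_ne (not_lt.1 ha) (hne a ⟨le_rfl, hab⟩)
      intro t ht
      by_contra hle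
      have hlt : 0 < deriv g t := lt_of_le_of_ne (not_lt.1 hle) (Ne.symm (hne t ht))
      have hsub : uIcc a t ⊆ Icc a b := by
        rw [uIcc_of_le ht.1]; exact Icc_subset_Icc le_rfl ht.2
      have h0 : (0 : ℝ) ∈ uIcc (deriv g a) (deriv g t) := by
        rw [uIcc_of_le (ha'.le.trans hlt.le)]; exact ⟨ha'.le, hlt.le⟩
      obtain ⟨c, hc, hc0⟩ := intermediate_value_uIcc hdc.continuousOn h0
      exact hne c (hsub hc) hc0
  rcases hsign with hpos | hneg
  · exact (strictMonoOn_of_deriv_pos (convex_Icc a b) hgc.continuousOn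
      (fun x hx => hpos x (interior_subset hx))).injOn
  · exact (strictAntiOn_of_deriv_neg (convex_Icc a b) hgc.continuousOn
      (fun x hx => hneg x (interior_subset hx))).injOn

/-- **(Z1) Non-degenerate zeros of a `C¹` function of one variable form a Lebesgue-null set**:
`vol {t | g t = 0 ∧ g′ t ≠ 0} = 0`.  Each such zero has a rational interval around it on which `g′ ≠ 0`, hence on which
`g` is injective and has at most one zero; the set is a countable union of subsingletons. [folklore] -/
theorem volume_setOf_eq_zero_inter_deriv_ne_zero {g : ℝ → ℝ} (hg : ContDiff ℝ 1 g) :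
    volume {t : ℝ | g t = 0 ∧ deriv g t ≠ 0} = 0 := by
  have hdc : Continuous (deriv g) := hg.continuous_deriv le_rfl
  set Z : Set ℝ := {t : ℝ | g t = 0 ∧ deriv g t ≠ 0} with hZ
  -- the countable family of rational intervals on which `g′` does not vanish
  set F : Set (ℚ × ℚ) := {q | ∀ t ∈ Icc (q.1 : ℝ) q.2, deriv g t ≠ 0} with hF
  have hcover : Z ⊆ ⋃ q ∈ F, Z ∩ Ioo (q.1 : ℝ) q.2 := by
    intro t₀ ht₀
    have hev : ∀ᶠ t in 𝓝 t₀, deriv g t ≠ 0 := hdc.continuousAt.eventually_ne ht₀.2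
    obtain ⟨ε, hε, hball⟩ := Metric.eventually_nhds_iff.1 hev
    obtain ⟨a, ha1, ha2⟩ := exists_rat_btwn (show t₀ - ε < t₀ by linarith)
    obtain ⟨b, hb1, hb2⟩ := exists_rat_btwn (show t₀ < t₀ + ε by linarith)
    have hq : ((a, b) : ℚ × ℚ) ∈ F := by
      intro t ht
      refine hball ?_
      rw [Real.dist_eq, abs_lt]
      constructor <;> linarith [ht.1, ht.2]
    exact mem_iUnion₂.2 ⟨(a, b), hq, ht₀, ha2, hb1⟩
  have hpiece : ∀ q ∈ F, volume (Z ∩ Ioo (q.1 : ℝ) q.2) = 0 := by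
    intro q hq
    refine Set.Subsingleton.measure_zero ?_ volume
    intro x hx y hy
    have hinj := injOn_Icc_of_deriv_ne_zero hg hq
    exact hinj (Ioo_subset_Icc_self hx.2) (Ioo_subset_Icc_self hy.2) (by rw [hx.1.1, hy.1.1])
  refine measure_mono_null hcover ?_
  exact (measure_biUnion_null_iff (to_countable F)).2 hpiece

/-! ## (Z2) Fubini on coordinate lines -/

/-- The coordinate line in the `j`-th direction: `t ↦ toLp (insertNth j t w)` is the affine line `ℓ(0) + t • eⱼ`.
[folklore] -/
theorem toLp_insertNth_eq_add_smul (j : Fin 3) (w : Fin 2 → ℝ) (t : ℝ) :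
    (toLp 2 (Fin.insertNth j t w) : EuclideanSpace ℝ (Fin 3)) =
      toLp 2 (Fin.insertNth j (0 : ℝ) w) + t • EuclideanSpace.single j (1 : ℝ) := by
  ext i
  rcases Fin.eq_self_or_eq_succAbove j i with rfl | ⟨k, rfl⟩
  · simp [Fin.insertNth_apply_same]
  · simp [Fin.insertNth_apply_succAbove, Fin.succAbove_ne]

/-- **(Z2) Fubini on `eⱼ`-lines**: for `f ∈ C¹(ℝ³)` the set of zeros at which the `j`-th partial derivative does not
vanish is Lebesgue-null — in the volume-preserving line coordinates `(w, t) ↦ toLp (insertNth j t w)` every `eⱼ`-line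
meets it in a (Z1)-set of `g = f ∘ line`. [folklore] -/
theorem volume_setOf_eq_zero_inter_fderiv_apply_ne_zero {f : EuclideanSpace ℝ (Fin 3) → ℝ}
    (hf : ContDiff ℝ 1 f) (j : Fin 3) :
    volume {z : EuclideanSpace ℝ (Fin 3) | f z = 0 ∧ fderiv ℝ f z (EuclideanSpace.single j 1) ≠ 0} = 0 := by
  set S : Set (EuclideanSpace ℝ (Fin 3)) :=
    {z | f z = 0 ∧ fderiv ℝ f z (EuclideanSpace.single j 1) ≠ 0} with hSdef
  -- measurability of `S`
  have hfc : Continuous f := hf.continuous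
  have hDc : Continuous fun z => fderiv ℝ f z (EuclideanSpace.single j 1) :=
    (hf.continuous_fderiv one_ne_zero).clm_apply continuous_const
  have hS : MeasurableSet S :=
    (isClosed_eq hfc continuous_const).measurableSet.inter
      ((isOpen_ne_fun hDc continuous_const).measurableSet)
  -- line coordinates `(w, t) ↦ toLp (insertNth j t w)` are volume preserving
  set L : (Fin 2 → ℝ) × ℝ → EuclideanSpace ℝ (Fin 3) :=
    fun p => toLp 2 ((MeasurableEquiv.piFinSuccAbove (fun _ : Fin 3 => ℝ) j).symm p.swap) with hLdef
  have hL : MeasurePreserving L volume volume :=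
    (PiLp.volume_preserving_toLp (Fin 3)).comp
      (((volume_preserving_piFinSuccAbove (fun _ : Fin 3 => ℝ) j).symm).comp
        (Measure.measurePreserving_swap (μ := (volume : Measure (Fin 2 → ℝ))) (ν := (volume : Measure ℝ))))
  have hLapply : ∀ w t, L (w, t) = toLp 2 (Fin.insertNth j t w) := fun w t => rfl
  -- `vol S = vol (L ⁻¹' S)`, and the latter vanishes line by line
  rw [← hL.measure_preimage hS.nullMeasurableSet]
  have hLS : MeasurableSet (L ⁻¹' S) := hL.measurable hS
  rw [show (volume : Measure ((Fin 2 → ℝ) × ℝ)) = (volume : Measure (Fin 2 → ℝ)).prod volume from rfl,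
    Measure.measure_prod_null hLS]
  refine Filter.Eventually.of_forall fun w => ?_
  -- the `w`-section is the (Z1)-set of `g = f ∘ line`
  set ℓ : ℝ → EuclideanSpace ℝ (Fin 3) := fun t => toLp 2 (Fin.insertNth j t w) with hℓ
  set P : EuclideanSpace ℝ (Fin 3) := toLp 2 (Fin.insertNth j (0 : ℝ) w) with hP
  have hℓeq : ℓ = fun t => P + t • EuclideanSpace.single j (1 : ℝ) :=
    funext fun t => toLp_insertNth_eq_add_smul j w t
  have hℓ' : ∀ t, HasDerivAt ℓ (EuclideanSpace.single j (1 : ℝ)) t := by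
    intro t
    rw [hℓeq]
    have h1 := ((hasDerivAt_id' t).smul_const (EuclideanSpace.single j (1 : ℝ))).const_add P
    rw [one_smul] at h1
    exact h1
  have hℓc : ContDiff ℝ 1 ℓ := by
    rw [hℓeq]
    exact contDiff_const.add (contDiff_id.smul contDiff_const)
  set g : ℝ → ℝ := f ∘ ℓ with hg
  have hgC : ContDiff ℝ 1 g := hf.comp hℓc
  have hgd : ∀ t, deriv g t = fderiv ℝ f (ℓ t) (EuclideanSpace.single j 1) := by
    intro t
    have hfd : HasFDerivAt f (fderiv ℝ f (ℓ t)) (ℓ t) :=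
      (hf.differentiable one_ne_zero (ℓ t)).hasFDerivAt
    exact (hfd.comp_hasDerivAt t (hℓ' t)).deriv
  have hsec : Prod.mk w ⁻¹' (L ⁻¹' S) = {t : ℝ | g t = 0 ∧ deriv g t ≠ 0} := by
    ext t
    simp only [mem_preimage, hLapply, hSdef, mem_setOf_eq]
    rw [hgd t]
    simp only [hg, hℓ, Function.comp_apply]
  show volume (Prod.mk w ⁻¹' (L ⁻¹' S)) = 0
  rw [hsec]
  exact volume_setOf_eq_zero_inter_deriv_ne_zero hgC

/-! ## (Z3) Vector fields: the zero set is null when the derivative vanishes at no zero -/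

/-- A continuous linear map of `ℝ³` that kills every coordinate vector is zero. [folklore] -/
theorem clm_eq_zero_of_apply_single_eq_zero {F : Type*} [NormedAddCommGroup F] [NormedSpace ℝ F]
    (A : EuclideanSpace ℝ (Fin 3) →L[ℝ] F) (h : ∀ j : Fin 3, A (EuclideanSpace.single j 1) = 0) : A = 0 := by
  have h' : (A : EuclideanSpace ℝ (Fin 3) →ₗ[ℝ] F) = 0 := by
    refine (EuclideanSpace.basisFun (Fin 3) ℝ).toBasis.ext fun j => ?_
    rw [OrthonormalBasis.coe_toBasis, EuclideanSpace.basisFun_apply, LinearMap.zero_apply]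
    exact h j
  exact ContinuousLinearMap.coe_injective h'

/-- **(Z3)** For `W ∈ C¹(ℝ³, ℝ³)` whose derivative vanishes at no zero of `W`, the zero set `{W = 0}` is Lebesgue-null:
`{W = 0} ⊆ ⋃ᵢⱼ {Wᵢ = 0 ∧ ∂ⱼWᵢ ≠ 0}`, nine (Z2)-sets. [folklore] -/
theorem volume_zeroSet_eq_zero_of_fderiv_ne_zero
    {W : EuclideanSpace ℝ (Fin 3) → EuclideanSpace ℝ (Fin 3)} (hW : ContDiff ℝ 1 W)
    (hDW : ∀ z, W z = 0 → fderiv ℝ W z ≠ 0) :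
    volume {z : EuclideanSpace ℝ (Fin 3) | W z = 0} = 0 := by
  -- the coordinate functions `Wᵢ = proj i ∘ W`
  have hfun : ∀ i : Fin 3, (fun z => W z i) = (EuclideanSpace.proj i : EuclideanSpace ℝ (Fin 3) →L[ℝ] ℝ) ∘ W :=
    fun i => funext fun z => by simp
  have hWi : ∀ i : Fin 3, ContDiff ℝ 1 (fun z => W z i) := fun i => by
    rw [hfun i]; exact (EuclideanSpace.proj i).contDiff.comp hW
  have hDi : ∀ (i : Fin 3) (z v : EuclideanSpace ℝ (Fin 3)),
      fderiv ℝ (fun z => W z i) z v = fderiv ℝ W z v i := by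
    intro i z v
    have h := ((EuclideanSpace.proj i : EuclideanSpace ℝ (Fin 3) →L[ℝ] ℝ).hasFDerivAt.comp z
      (hW.differentiable one_ne_zero z).hasFDerivAt).fderiv
    rw [hfun i, h]
    simp
  -- covering by the nine (Z2)-sets
  have hcover : {z : EuclideanSpace ℝ (Fin 3) | W z = 0} ⊆
      ⋃ i : Fin 3, ⋃ j : Fin 3,
        {z | (fun z => W z i) z = 0 ∧ fderiv ℝ (fun z => W z i) z (EuclideanSpace.single j 1) ≠ 0} := by
    intro z hz
    have hz0 : W z = 0 := hz
    -- some `∂ⱼW(z) ≠ 0`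
    have hj : ∃ j : Fin 3, fderiv ℝ W z (EuclideanSpace.single j 1) ≠ 0 := by
      by_contra h
      push Not at h
      exact hDW z hz0 (clm_eq_zero_of_apply_single_eq_zero _ h)
    obtain ⟨j, hj⟩ := hj
    -- some coordinate of it is nonzero
    have hi : ∃ i : Fin 3, fderiv ℝ W z (EuclideanSpace.single j 1) i ≠ 0 := by
      by_contra h
      push Not at h
      exact hj (PiLp.ext h)
    obtain ⟨i, hi⟩ := hi
    refine mem_iUnion.2 ⟨i, mem_iUnion.2 ⟨j, ?_, ?_⟩⟩
    · show W z i = 0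
      rw [hz0]; rfl
    · rw [hDi]; exact hi
  refine measure_mono_null hcover ?_
  refine (measure_iUnion_null_iff).2 fun i => (measure_iUnion_null_iff).2 fun j => ?_
  exact volume_setOf_eq_zero_inter_fderiv_apply_ne_zero (hWi i) j

/-! ## (N2) The stagnation set of the similarity wind is null -/

variable {γ : ℝ} {U : EuclideanSpace ℝ (Fin 3) → EuclideanSpace ℝ (Fin 3)} {P : EuclideanSpace ℝ (Fin 3) → ℝ}

/-- The similarity wind `W = γ y + U` of a self-similar Euler profile is `C¹` (indeed `C²`). [folklore] -/
theorem contDiff_selfSimilarTransport (hprof : IsSelfSimilarEulerProfile γ 0 U P) :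
    ContDiff ℝ 1 (selfSimilarTransport γ 0 U) := by
  have hU : ContDiff ℝ 1 U := hprof.contDiff_velocity.of_le (by norm_num)
  have h : ContDiff ℝ 1 (fun y : EuclideanSpace ℝ (Fin 3) => γ • (y - 0) + U y) :=
    ((contDiff_id.sub contDiff_const).const_smul γ).add hU
  have hfun : selfSimilarTransport γ 0 U = fun y : EuclideanSpace ℝ (Fin 3) => γ • (y - 0) + U y :=
    funext fun y => by simp [selfSimilarTransport]
  rw [hfun]
  exact h

/-- **(N2) THE STAGNATION SET IS LEBESGUE-NULL.**  For a self-similar Euler profile `(U, P)` with `γ ≠ 0`, the zero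
set `𝒩 = {y | γ y + U(y) = 0}` of the similarity wind has Lebesgue measure zero: by (N1) (t40e) `‖DW‖ ≥ |γ| > 0`
everywhere, and (Z3). [folklore] -/
theorem volume_stagnationSet_eq_zero (hprof : IsSelfSimilarEulerProfile γ 0 U P) (hγ : γ ≠ 0) :
    volume {z : EuclideanSpace ℝ (Fin 3) | selfSimilarTransport γ 0 U z = 0} = 0 := by
  refine volume_zeroSet_eq_zero_of_fderiv_ne_zero (contDiff_selfSimilarTransport hprof) fun z _ hD => ?_
  have h := abs_le_norm_fderiv_selfSimilarTransport_of_profile hprof z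
  rw [hD, norm_zero] at h
  exact hγ (abs_nonpos_iff.1 h)

/-- (N2), almost-everywhere form: `W ≠ 0` for a.e. `y`. [folklore] -/
theorem ae_selfSimilarTransport_ne_zero (hprof : IsSelfSimilarEulerProfile γ 0 U P) (hγ : γ ≠ 0) :
    ∀ᵐ z : EuclideanSpace ℝ (Fin 3), selfSimilarTransport γ 0 U z ≠ 0 := by
  rw [ae_iff]
  simpa only [not_not] using volume_stagnationSet_eq_zero hprof hγ

end Summit.NavierStokesRegularity.NavierStokesRegularity.Theorems.PowerGaugeEulerLiouville.Stagnation

end
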